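import Summits.ABC.ABC.Theses.IsogenyGlueCongruence
import Summits.ABC.ABC.Theses.RibetTakahashiSplit
import Summits.ABC.ABC.Theorems.IsogenyGlueCongruenceMazurKenkuBoundOfRadius
import Summits.ABC.ABC.Theorems.IsogenyGlueCongruenceMazurKenkuBoundStubCertEleven
import Summits.ABC.ABC.Theorems.IsogenyGlueCongruenceMazurKenkuBoundStubCertMid
import Summits.ABC.ABC.Theorems.IsogenyGlueCongruenceMazurKenkuBoundStubCertCM
import Summits.ABC.ABC.Theorems.IsogenyGlueCongruenceMazurKenkuBoundStubEightyone
import Literature.NumberTheory.EllipticCurves.KenkuMinimalLevelsKleinFrickeFiveSeven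
import Literature.NumberTheory.EllipticCurves.OpenImageMazurInputsProofs
import HarnessLib

/-!
# Route `IsogenyGlueCongruence`, crux `MazurKenkuBound` (stmt-ABC-15125) — line `Sketch`,
# skeleton of the continuation lead c21 (cycle 22): `stub_radius` RE-EXPANDED along the tree's
# exact decomposition of the Mazur–Kenku radius, with Kenku's case (c) as certificate stubs

Cycle 22 (lead c21, 2026-08-17). Since cycle 20 the crux is `mazurKenkuBound_of_radiusItem`
applied to ONE stub, `stub_radius` = the sibling crux stmt-ABC-15193 (`MazurKenkuRadius`: two
`ℚ`-isogenous elliptic curves over `ℚ` are joined by a `ℚ`-isogeny of degree `≤ 163`; Mazur 1978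
Thm. 1 + Kenku 1982). That item has no lead and no skeleton. The tree meanwhile decomposes it
EXACTLY (`mazurKenku_iff_mazur_and_kenku`, `mazur_isogeny_irreducible_holds_of`,
`kenku_minimalLevels_mem_kenkuDegrees_of_schemas`, all landed 2026-08-16) into:

* Mazur 1978, Cor. 4.4 (`Mazur1978.cor44_valuation_j_le_one`; the Eisenstein quotient — XL, no
  modular curves over `ℤ` in the tree) — `stub_cor44`; Prop. 5.1 is a THEOREM
  (`Mazur1978.prop51_exponent_classes_of_additive_holds`);
* Kenku's inputs with no counterpart in the tree: the uniqueness schema `hU` and the `j`-tables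
  `hT` of the rational cyclic `N`-isogenies, `N ∈ {11, 14, 15, 17, 19, 21, 27, 37, 43, 67, 163}`
  (Ligozat, Vélu, Mazur–Swinnerton-Dyer, Mazur; determinations of `X₀(N)(ℚ)`) —
  `stub_kenkuTablesUnique`; and the 13 direct levels `20, 24, 26, 32, 35, 36, 39, 49, 50, 65, 91,
  125, 169` (Ligozat, Kubert, Mazur–Vélu, Kenku 1979–81) — `stub_kenkuDirect`;
* Kenku's case (c) at `N' ∈ {7, 13}` and the level `81`, which ARE provable now from the landed
  Frobenius-certificate glue (`exists_root_of_isogeny_prime_degree_of_j_eq`,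
  `Mazur1978.exists_root_charpoly_mod_of_cyclicCharacter`, the kernel-decided
  `RationalIsogenyFrobeniusCertificates*`): no `ℚ`-isogeny of degree `7` or `13` out of a curve
  whose `j` is in the table of `11` (`stub_certEleven`), of `17, 19, 37` (`stub_certMid`), of
  `43, 67, 163` (`stub_certCM`), and no cyclic `81`-isogeny out of `j = -2¹⁵·3·5³`
  (`stub_eightyone`). (The tree's `…_of_schemas₂` already removes the levels `5N`, `7N` by
  Klein–Fricke, but its level-`7` branch rests on `native_decide` certificates — axioms outside the
  gate's whitelist — so this skeleton uses the axiom-clean `…_of_schemas` and the clean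
  `isCyclic_degree_ne_five_mul_of_jTable`, and re-derives the `7N` levels by certificates.)

Composition (`MazurKenkuBound_of`, proved below modulo the stubs): stubs ⟹ `hRest` of
`kenku_minimalLevels_mem_kenkuDegrees_of_schemas` (`hRest_of_stubs`) ⟹ Kenku's fact ⟹ with
`stub_cor44` and Prop. 5.1 Mazur's Thm. 1 ⟹ `mazurKenku_exists_cyclic_isogeny` ⟹ the radius
(`exists_isogeny_degree_le_163`) ⟹ the crux (`mazurKenkuBound_of_radiusItem`, p135527).
-/

-- `Summit.<Summit>.<Problem>` is the mandated summit-side namespace (CONVENTIONS §2); for the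
-- single-conjunct summit `ABC` the two coincide, so the duplicate `ABC.ABC` is deliberate.
set_option linter.dupNamespace false

noncomputable section

open scoped Classical

open WeierstrassCurve
open Literature.NumberTheory.EllipticCurves

namespace Summit.ABC.ABC.Theorems

/-! ### Stub 1: Mazur 1978, Cor. 4.4 (the Eisenstein quotient) — XL named fact -/

/-- STUB (XL printed theorem; verbatim the named fact `Mazur1978.cor44_valuation_j_le_one` of
`OpenImageMazurInputs.lean`): an elliptic curve over `ℚ` with a rational `N`-isogeny, `N = 11` or
`N ≥ 17` prime, has potentially good reduction at every odd prime (finiteness of `J̃(ℚ)` for the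
Eisenstein quotient `J̃` of `J₀(N)` and the formal immersion at `∞`).
[cite: Mazur1978, Cor. 4.4 (p. 145), with Cor. 4.3 and Prop. 3.1] -/
theorem stub_cor44 : Mazur1978.cor44_valuation_j_le_one := by
  sorry

/-! ### Stub 2: Kenku's tables — uniqueness `hU` and the `j`-tables `hT` (no tree counterpart) -/

/-- STUB (printed determinations of `X₀(N)(ℚ)`, verbatim the hypothesis schemas `hU`, `hT` of the
tree's `kenku_minimalLevels_mem_kenkuDegrees_of_schemas`): (`hU`) two rational cyclic
`N`-subgroups never coexist on an elliptic curve over `ℚ`, `N ∈ {11, 17, 19, 37, 43, 67, 163, 14,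
15, 21}`; (`hT`) a rational cyclic `N`-isogeny, `N ∈ {11, 14, 15, 17, 19, 21, 27, 37, 43, 67, 163}`,
has `(N, j) ∈ kenkuIsogenyJTable` (Ligozat 1975, Vélu, Mazur–Swinnerton-Dyer 1974, Mazur 1978,
Antwerp IV; Kenku 1982 p. 200). [cite: Kenku1982, proof of Thm. 1, p. 200]
[cite: CremonaAlgorithms1997, §3.8 p. 82 and Table 1] -/
theorem stub_kenkuTablesUnique :
    (∀ N ∈ ({11, 17, 19, 37, 43, 67, 163, 14, 15, 21} : Finset ℕ),
      ∀ (V V₂ V₃ : WeierstrassCurve ℚ) [V.IsElliptic] [V₂.IsElliptic] [V₃.IsElliptic]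
        (ψ₁ : Isogeny V V₂) (ψ₂ : Isogeny V V₃), ψ₁.IsCyclic → ψ₂.IsCyclic →
        ψ₁.degree = N → ψ₂.degree = N → ψ₁.toAddMonoidHom.ker = ψ₂.toAddMonoidHom.ker) ∧
    (∀ (V V' : WeierstrassCurve ℚ) [V.IsElliptic] [V'.IsElliptic] (ψ : Isogeny V V'),
      ψ.IsCyclic → ψ.degree ∈ ({11, 14, 15, 17, 19, 21, 27, 37, 43, 67, 163} : Finset ℕ) →
        (ψ.degree, V.j) ∈ kenkuIsogenyJTable) := by
  sorry

/-! ### Stub 3 (reshaped in wave 2): Kenku's TWELVE direct levels other than `32` -/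

/-- STUB (printed determinations `Y₀(N)(ℚ) = ∅`): no cyclic `ℚ`-isogeny of an elliptic curve over
`ℚ` has degree `20, 24, 26, 35, 36, 39, 49, 50, 65, 91, 125` or `169` (genus one: Ligozat 1975,
Kubert 1976; `26, 35, 39, 50, 65, 91, 125, 169`: Mazur–Vélu, Kenku 1979–81, as assembled in Kenku
1982). The level `32` is split off (stubs 8–11 below: modular-curve-free, after the idea card
`fermat-quartic-two-part` of the crux `IsogenyDegreeBound`, stmt-ABC-15192).
[cite: Kenku1982, proof of Thm. 1, pp. 200–201] [cite: Ligozat1975] -/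
theorem stub_kenkuDirect12 :
    ∀ (V V' : WeierstrassCurve ℚ) [V.IsElliptic] [V'.IsElliptic] (ψ : Isogeny V V'),
      ψ.IsCyclic → ψ.degree ∉ ({20, 24, 26, 35, 36, 39, 49, 50, 65, 91, 125, 169} : Finset ℕ) := by
  sorry

/-! ### Stubs 8–11 (wave 2): no cyclic `ℚ`-isogeny of degree `32`, by a chain of explicit
### `2`-isogenies and Fermat's descent on `y² = x³ − x` (modular-curve-free)

A cyclic `Γ_ℚ`-stable `C` of order `2ᵏ` on `y² = x³ + ax² + bx` with `C[2] = ⟨(0,0)⟩`: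
(vertex) if `k ≥ 2`, the points `Q` with `2Q = (0,0)` have `x(Q)² = b` and `⟨Q⟩ = C[4]` is
stable, so `x(Q) ∈ ℚ` and `b = d²`; (step) Silverman's `2`-isogeny `φ` (`twoIsogeny`, kernel
`{O, (0,0)}`) maps `C` onto a stable cyclic group of order `2ᵏ⁻¹` on
`Y² = X(X² − 2aX + a² − 4d²)`, whose `2`-torsion point is `(a + 2e, 0)`, `e = ±d` (not `(0,0)`,
which is `φ` of the other `2`-torsion points); moving it to the origin gives
`y² = x³ + (a + 6e)x² + 4e(a + 2e)x`. Three steps from order `32` and the vertex condition at each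
level give rationals with `e₁² = 4e₀(a₀ + 2e₀)`, `e₂² = 4e₁(a₁ + 2e₁)`, `d₃² = 4e₂(a₂ + 2e₂)`
(`aᵢ₊₁ = aᵢ + 6eᵢ`), which force a rational point with `y ≠ 0` on `y² = x³ − x`
(`x = e₂/(e₁ + 4e₀)` on `y² = x³ + 4x`, then the `2`-isogenous curve) — excluded by the tree's
`MestreOesterle.eq_zero_of_sq_eq_cube_sub_self` (Fermat). -/

/-- STUB 8 (normalisation): a cyclic `ℚ`-isogeny of degree `2ᵏ`, `k ≥ 1`, out of an elliptic curve
over `ℚ` yields, on a `ℚ`-isomorphic model `y² = x³ + ax² + bx`, a `Γ_ℚ`-stable cyclic subgroup of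
order `2ᵏ` whose element of order `2` is `T = (0,0)` (the kernel; its `2`-torsion point is
`Γ_ℚ`-fixed hence rational, and is moved to `(0,0)` by `isTwoTorsionNF_smul_of_two_nsmul_eq_zero`;
transport along `geomPointsEquiv`). [cite: SilvermanAEC2009, III.4 Example 4.5, X.4.9] -/
theorem stub_twoNormalize :
    ∀ (W W' : WeierstrassCurve ℚ) [W.IsElliptic] [W'.IsElliptic] (ψ : Isogeny W W') (k : ℕ),
      1 ≤ k → ψ.IsCyclic → ψ.degree = 2 ^ k →
      ∃ (a b : ℚ) (_ : (⟨0, a, 0, b, 0⟩ : WeierstrassCurve ℚ).IsElliptic)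
        (C : AddSubgroup (⟨0, a, 0, b, 0⟩ : WeierstrassCurve ℚ).geomPoints),
        (∀ σ : Field.absoluteGaloisGroup ℚ, ∀ P ∈ C, σ • P ∈ C) ∧ IsAddCyclic C ∧
          Nat.card C = 2 ^ k ∧
          ∀ P ∈ C, 2 • P = 0 → P ≠ 0 →
            P = (⟨0, a, 0, b, 0⟩ : WeierstrassCurve ℚ).geomTwoTorsionPoint := by
  sorry

/-- STUB 9 (vertex criterion): on an elliptic `y² = x³ + ax² + bx` over `ℚ`, a `Γ_ℚ`-stable cyclic
subgroup of order `2ᵏ`, `k ≥ 2`, whose element of order `2` is `T = (0,0)` forces `b` to be a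
square: a point `Q` of order `4` in it has `2Q = T`, so `x(Q)² = b` by the duplication formula
(`addX_self_mul`), and `σQ = ±Q` for all `σ`, so `x(Q) ∈ ℚ`. [cite: SilvermanAEC2009, III.2.3 (d)] -/
theorem stub_twoVertex :
    ∀ (a b : ℚ) [(⟨0, a, 0, b, 0⟩ : WeierstrassCurve ℚ).IsElliptic]
      (C : AddSubgroup (⟨0, a, 0, b, 0⟩ : WeierstrassCurve ℚ).geomPoints) (k : ℕ), 2 ≤ k →
      (∀ σ : Field.absoluteGaloisGroup ℚ, ∀ P ∈ C, σ • P ∈ C) → IsAddCyclic C → Nat.card C = 2 ^ k →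
      (∀ P ∈ C, 2 • P = 0 → P ≠ 0 →
        P = (⟨0, a, 0, b, 0⟩ : WeierstrassCurve ℚ).geomTwoTorsionPoint) →
      ∃ d : ℚ, b = d ^ 2 := by
  sorry

/-- STUB 10 (one step down the chain): on an elliptic `y² = x³ + ax² + d²x` over `ℚ`, a
`Γ_ℚ`-stable cyclic `C` of order `2ᵏ`, `k ≥ 2`, with `C[2] = ⟨(0,0)⟩` is carried by Silverman's
`2`-isogeny (`twoIsogeny`, kernel `{O, (0,0)}`; codomain `Y² = X³ − 2aX² + (a² − 4d²)X` with
`2`-torsion `X ∈ {0, a + 2d, a − 2d}`) onto a stable cyclic group of order `2ᵏ⁻¹` whose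
`2`-torsion point is `(a + 2e, 0)`, `e = ±d`; the shift `x ↦ x + (a + 2e)` puts it at the origin of
`y² = x³ + (a + 6e)x² + 4e(a + 2e)x`. [cite: SilvermanAEC2009, III.4 Example 4.5] -/
theorem stub_twoStep :
    ∀ (a d : ℚ) [(⟨0, a, 0, d ^ 2, 0⟩ : WeierstrassCurve ℚ).IsElliptic]
      (C : AddSubgroup (⟨0, a, 0, d ^ 2, 0⟩ : WeierstrassCurve ℚ).geomPoints) (k : ℕ), 2 ≤ k →
      (∀ σ : Field.absoluteGaloisGroup ℚ, ∀ P ∈ C, σ • P ∈ C) → IsAddCyclic C → Nat.card C = 2 ^ k →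
      (∀ P ∈ C, 2 • P = 0 → P ≠ 0 →
        P = (⟨0, a, 0, d ^ 2, 0⟩ : WeierstrassCurve ℚ).geomTwoTorsionPoint) →
      ∃ e : ℚ, (e = d ∨ e = -d) ∧
        ∃ (_ : (⟨0, a + 6 * e, 0, 4 * e * (a + 2 * e), 0⟩ : WeierstrassCurve ℚ).IsElliptic)
          (C' : AddSubgroup
            (⟨0, a + 6 * e, 0, 4 * e * (a + 2 * e), 0⟩ : WeierstrassCurve ℚ).geomPoints),
          (∀ σ : Field.absoluteGaloisGroup ℚ, ∀ P ∈ C', σ • P ∈ C') ∧ IsAddCyclic C' ∧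
            Nat.card C' = 2 ^ (k - 1) ∧
            ∀ P ∈ C', 2 • P = 0 → P ≠ 0 →
              P = (⟨0, a + 6 * e, 0, 4 * e * (a + 2 * e), 0⟩ :
                WeierstrassCurve ℚ).geomTwoTorsionPoint := by
  sorry

/-- STUB 11 (the Diophantine end): the three vertex relations of a chain of length three have no
rational solution — with `x = e₂/(e₁ + 4e₀)` one gets `y² = x³ + 4x`, `x ∉ {0, ±2}`, and the
`2`-isogenous point `((x² + 4)/(4x), y(x² − 4)/(8x²))` of `Y² = X³ − X` would have `Y ≠ 0`,
against Fermat (tree: `MestreOesterle.eq_zero_of_sq_eq_cube_sub_self`). [cite: Knapp1993, Cor. 4.22] -/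
theorem stub_twoChainAlgebra :
    ∀ (a₀ e₀ e₁ e₂ d₃ : ℚ), e₀ ≠ 0 → e₁ ≠ 0 → e₂ ≠ 0 →
      e₁ ^ 2 = 4 * e₀ * (a₀ + 2 * e₀) →
      e₂ ^ 2 = 4 * e₁ * (a₀ + 6 * e₀ + 2 * e₁) →
      d₃ ^ 2 = 4 * e₂ * (a₀ + 6 * e₀ + 6 * e₁ + 2 * e₂) →
      (a₀ + 6 * e₀) ^ 2 ≠ 4 * e₁ ^ 2 →
      (a₀ + 6 * e₀ + 6 * e₁) ^ 2 ≠ 4 * e₂ ^ 2 → False := by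
  sorry

/-! ### Stubs 4–7: LANDED (wave 1 of lead c21, 2026-08-17) — imported above
* `stub_certEleven` — `Theorems/IsogenyGlueCongruenceMazurKenkuBoundStubCertEleven.lean` (p137957):
  no `ℚ`-isogeny of degree `7` or `13` out of `j ∈ {-11², -11·131³, -2¹⁵}`;
* `stub_certMid` — `…StubCertMid.lean` (p138082): the same for the tables of `X₀(17)`, `X₀(19)`,
  `X₀(37)`;
* `stub_certCM` — `…StubCertCM.lean` (p138194): the same for `j = -960³, -5280³, -640320³`;
* `stub_eightyone` — `…StubEightyone.lean` (p138666): no cyclic `81`-isogeny out of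
  `j = -2¹⁵·3·5³` (prime-power certificate modulo `81`);
all over the landed criterion `Literature/NumberTheory/EllipticCurves/RationalIsogenyFrobeniusCriterion.lean`
(p137606) and the kernel-decided `RationalIsogenyFrobeniusCertificates*.lean`.
-/

/-! ### Composition (kernel-checked; not stubs) -/

/-- Transport of the chain data along an equality of the coefficient `b` (bookkeeping). [folklore] -/
theorem twoChain_transport {a b b' : ℚ} (h : b = b') {k : ℕ}
    (H : ∃ (_ : (⟨0, a, 0, b, 0⟩ : WeierstrassCurve ℚ).IsElliptic)
      (C : AddSubgroup (⟨0, a, 0, b, 0⟩ : WeierstrassCurve ℚ).geomPoints),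
      (∀ σ : Field.absoluteGaloisGroup ℚ, ∀ P ∈ C, σ • P ∈ C) ∧ IsAddCyclic C ∧
        Nat.card C = 2 ^ k ∧
        ∀ P ∈ C, 2 • P = 0 → P ≠ 0 →
          P = (⟨0, a, 0, b, 0⟩ : WeierstrassCurve ℚ).geomTwoTorsionPoint) :
    ∃ (_ : (⟨0, a, 0, b', 0⟩ : WeierstrassCurve ℚ).IsElliptic)
      (C : AddSubgroup (⟨0, a, 0, b', 0⟩ : WeierstrassCurve ℚ).geomPoints),
      (∀ σ : Field.absoluteGaloisGroup ℚ, ∀ P ∈ C, σ • P ∈ C) ∧ IsAddCyclic C ∧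
        Nat.card C = 2 ^ k ∧
        ∀ P ∈ C, 2 • P = 0 → P ≠ 0 →
          P = (⟨0, a, 0, b', 0⟩ : WeierstrassCurve ℚ).geomTwoTorsionPoint := by
  subst h
  exact H

/-- One level of the chain, vertex included: from the chain data of order `2ᵏ`, `k ≥ 3`, on
`y² = x³ + ax² + d²x`, the chain data of order `2ᵏ⁻¹` on `y² = x³ + (a + 6e)x² + d'²x` with
`e = ±d` and `d'² = 4e(a + 2e)` (stubs 10 and 9 and the transport). [folklore] -/
theorem twoChain_level {a d : ℚ} {k : ℕ} (hk : 3 ≤ k)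
    (H : ∃ (_ : (⟨0, a, 0, d ^ 2, 0⟩ : WeierstrassCurve ℚ).IsElliptic)
      (C : AddSubgroup (⟨0, a, 0, d ^ 2, 0⟩ : WeierstrassCurve ℚ).geomPoints),
      (∀ σ : Field.absoluteGaloisGroup ℚ, ∀ P ∈ C, σ • P ∈ C) ∧ IsAddCyclic C ∧
        Nat.card C = 2 ^ k ∧
        ∀ P ∈ C, 2 • P = 0 → P ≠ 0 →
          P = (⟨0, a, 0, d ^ 2, 0⟩ : WeierstrassCurve ℚ).geomTwoTorsionPoint) :
    ∃ e d' : ℚ, (e = d ∨ e = -d) ∧ d' ^ 2 = 4 * e * (a + 2 * e) ∧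
      ∃ (_ : (⟨0, a + 6 * e, 0, d' ^ 2, 0⟩ : WeierstrassCurve ℚ).IsElliptic)
        (C : AddSubgroup (⟨0, a + 6 * e, 0, d' ^ 2, 0⟩ : WeierstrassCurve ℚ).geomPoints),
        (∀ σ : Field.absoluteGaloisGroup ℚ, ∀ P ∈ C, σ • P ∈ C) ∧ IsAddCyclic C ∧
          Nat.card C = 2 ^ (k - 1) ∧
          ∀ P ∈ C, 2 • P = 0 → P ≠ 0 →
            P = (⟨0, a + 6 * e, 0, d' ^ 2, 0⟩ : WeierstrassCurve ℚ).geomTwoTorsionPoint := by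
  obtain ⟨hE, C, hst, hcyc, hcard, h2⟩ := H
  obtain ⟨e, he, hE', C', hst', hcyc', hcard', h2'⟩ :=
    stub_twoStep a d C k (by omega) hst hcyc hcard h2
  haveI := hE'
  obtain ⟨d', hd'⟩ :=
    stub_twoVertex (a + 6 * e) (4 * e * (a + 2 * e)) C' (k - 1) (by omega) hst' hcyc' hcard' h2'
  exact ⟨e, d', he, hd'.symm, twoChain_transport hd' ⟨hE', C', hst', hcyc', hcard', h2'⟩⟩

/-- Nondegeneracy of one level: `y² = x³ + Ax² + Bx` elliptic with `B = E²` gives `E ≠ 0` and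
`A² ≠ 4E²` (`Δ = 16B²(A² − 4B)`; the tree's `a₄_ne_zero`, `a₂_sq_sub_ne_zero`). [folklore] -/
theorem twoChain_nondeg {A B E : ℚ} [hEll : (⟨0, A, 0, B, 0⟩ : WeierstrassCurve ℚ).IsElliptic]
    (hB : B = E ^ 2) : E ≠ 0 ∧ A ^ 2 ≠ 4 * E ^ 2 := by
  have h4 := WeierstrassCurve.a₄_ne_zero (⟨0, A, 0, B, 0⟩ : WeierstrassCurve ℚ)
  have h2 := WeierstrassCurve.a₂_sq_sub_ne_zero (⟨0, A, 0, B, 0⟩ : WeierstrassCurve ℚ)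
  simp only at h4 h2
  refine ⟨?_, ?_⟩
  · rintro rfl
    exact h4 (by rw [hB]; ring)
  · intro h
    exact h2 (by rw [hB, h]; ring)

/-- **No cyclic `ℚ`-isogeny of degree `32`** (Kenku's level `32`, i.e. `Y₀(32)(ℚ) = ∅`; Ligozat
1975 / Kenku 1982), from stubs 8–11: normalise (stub 8), vertex at level `0` (stub 9), three
levels of the chain (`twoChain_level`, orders `32 → 16 → 8 → 4`), the vertex at level `3`
(stub 9, order `4`), and the Diophantine end (stub 11). Modular-curve-free; after the idea card
`fermat-quartic-two-part` (crux stmt-ABC-15192). [cite: Kenku1982, proof of Thm. 1, p. 201]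
[cite: Knapp1993, Cor. 4.22] -/
theorem isCyclic_degree_ne_thirtyTwo_of_stubs :
    ∀ (V V' : WeierstrassCurve ℚ) [V.IsElliptic] [V'.IsElliptic] (ψ : Isogeny V V'),
      ψ.IsCyclic → ψ.degree ≠ 32 := by
  intro V V' _ _ ψ hψ hdeg
  -- level 0: order 32 on `y² = x³ + a₀x² + b₀x`, then `b₀ = d₀²`
  obtain ⟨a₀, b₀, hE₀, C₀, hst₀, hcyc₀, hcard₀, h2₀⟩ :=
    stub_twoNormalize V V' ψ 5 (by norm_num) hψ (by rw [hdeg]; norm_num)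
  haveI := hE₀
  obtain ⟨d₀, hb₀⟩ := stub_twoVertex a₀ b₀ C₀ 5 (by norm_num) hst₀ hcyc₀ hcard₀ h2₀
  have H₀ := twoChain_transport (k := 5) hb₀ ⟨hE₀, C₀, hst₀, hcyc₀, hcard₀, h2₀⟩
  -- levels 1, 2, 3
  obtain ⟨e₀, d₁, he₀, hd₁, H₁⟩ := twoChain_level (k := 5) (by norm_num) H₀
  obtain ⟨e₁, d₂, he₁, hd₂, H₂⟩ := twoChain_level (k := 4) (by norm_num) H₁
  obtain ⟨e₂, d₃, he₂, hd₃, H₃⟩ := twoChain_level (k := 3) (by norm_num) H₂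
  -- nondegeneracy at levels 0, 1, 2
  obtain ⟨hE₀', -⟩ := H₀
  obtain ⟨hE₁', -⟩ := H₁
  obtain ⟨hE₂', -⟩ := H₂
  have n₀ := (twoChain_nondeg (hEll := hE₀') rfl).1
  have n₁ := twoChain_nondeg (hEll := hE₁') rfl
  have n₂ := twoChain_nondeg (hEll := hE₂') rfl
  -- `eᵢ = ±dᵢ`: nonvanishing and the relations in terms of the `eᵢ`
  have he₀0 : e₀ ≠ 0 := by rcases he₀ with rfl | rfl <;> simp [n₀]
  have he₁0 : e₁ ≠ 0 := by rcases he₁ with rfl | rfl <;> simp [n₁.1]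
  have he₂0 : e₂ ≠ 0 := by rcases he₂ with rfl | rfl <;> simp [n₂.1]
  have hsq₁ : e₁ ^ 2 = d₁ ^ 2 := by rcases he₁ with rfl | rfl <;> ring
  have hsq₂ : e₂ ^ 2 = d₂ ^ 2 := by rcases he₂ with rfl | rfl <;> ring
  refine stub_twoChainAlgebra a₀ e₀ e₁ e₂ d₃ he₀0 he₁0 he₂0 (by rw [hsq₁, hd₁])
    (by rw [hsq₂, hd₂]) hd₃ ?_ ?_
  · rw [hsq₁]; exact n₁.2
  · rw [hsq₂]; exact n₂.2

/-- Kenku's thirteen direct levels from the twelve of `stub_kenkuDirect12` and the level `32`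
(`isCyclic_degree_ne_thirtyTwo_of_stubs`). [cite: Kenku1982, proof of Thm. 1, pp. 200–201] -/
theorem stub_kenkuDirect :
    ∀ (V V' : WeierstrassCurve ℚ) [V.IsElliptic] [V'.IsElliptic] (ψ : Isogeny V V'),
      ψ.IsCyclic → ψ.degree ∉ ({20, 24, 26, 32, 35, 36, 39, 49, 50, 65, 91, 125, 169} : Finset ℕ) := by
  intro V V' _ _ ψ hψ hmem
  have hsplit : ∀ n ∈ ({20, 24, 26, 32, 35, 36, 39, 49, 50, 65, 91, 125, 169} : Finset ℕ),
      n = 32 ∨ n ∈ ({20, 24, 26, 35, 36, 39, 49, 50, 65, 91, 125, 169} : Finset ℕ) := by decide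
  rcases hsplit _ hmem with h32 | h12
  · exact isCyclic_degree_ne_thirtyTwo_of_stubs V V' ψ hψ h32
  · exact stub_kenkuDirect12 V V' ψ hψ h12

/-- The 35 residual levels of `kenku_minimalLevels_mem_kenkuDegrees_of_schemas` split as: the 13
direct levels, `5N`, `7N`, `13N` for `N ∈ {11, 17, 19, 37, 43, 67, 163}`, and `81` (finite check).
[cite: Kenku1982, proof of Thm. 1, pp. 200–201] -/
theorem residualLevels_split :
    ∀ n ∈ ({20, 24, 26, 32, 35, 36, 39, 49, 50, 65, 91, 125, 169, 55, 85, 95, 185, 215, 335, 815,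
        77, 119, 133, 259, 301, 469, 1141, 143, 221, 247, 481, 559, 871, 2119, 81} : Finset ℕ),
      n ∈ ({20, 24, 26, 32, 35, 36, 39, 49, 50, 65, 91, 125, 169} : Finset ℕ) ∨
        (∃ N ∈ ({11, 17, 19, 37, 43, 67, 163} : Finset ℕ), n = 5 * N) ∨
        (∃ N ∈ ({11, 17, 19, 37, 43, 67, 163} : Finset ℕ), n = 7 * N) ∨
        (∃ N ∈ ({11, 17, 19, 37, 43, 67, 163} : Finset ℕ), n = 13 * N) ∨ n = 81 := by
  decide

/-- The large-prime entries of `kenkuIsogenyJTable` have their `j` among the eleven tabulated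
values, grouped as in stubs 4–6 (finite check). [cite: CremonaAlgorithms1997, §3.8 p. 82] -/
theorem kenkuIsogenyJTable_large :
    ∀ r ∈ kenkuIsogenyJTable, r.1 ∈ ({11, 17, 19, 37, 43, 67, 163} : Finset ℕ) →
      r.2 ∈ ({-121, -24729001, -32768} : Finset ℚ) ∨
        r.2 ∈ ({-297756989 / 2, -882216989 / 131072, -884736, -9317, -162677523113838677} :
          Finset ℚ) ∨
        r.2 ∈ ({-884736000, -147197952000, -262537412640768000} : Finset ℚ) := by
  decide +kernel

/-- The only entry of `kenkuIsogenyJTable` at level `27` is `j = -12288000` (finite check).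
[cite: Kenku1982, proof of Thm. 1, p. 200] -/
theorem kenkuIsogenyJTable_twentyseven :
    ∀ r ∈ kenkuIsogenyJTable, r.1 = 27 → r.2 = -12288000 := by
  decide +kernel

/-- **The residual schema `hRest` of `kenku_minimalLevels_mem_kenkuDegrees_of_schemas` from the
stubs**: a cyclic `ℚ`-isogeny `ψ` has degree outside the 35 residual levels. Direct levels:
`stub_kenkuDirect`; `5N`: the tree's axiom-clean Klein–Fricke theorem
`isCyclic_degree_ne_five_mul_of_jTable`; `7N`, `13N`: the cyclic `N`-sub-isogeny out of the same
curve (`Isogeny.exists_isCyclic_degree_eq_of_dvd`) puts `j` in the table (`hT`), the `7`- resp.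
`13`-sub-isogeny is excluded by stubs 4–6; `81`: the cyclic `27`-sub-isogeny gives
`j = -12288000` (`hT`) and `stub_eightyone` applies. [cite: Kenku1982, proof of Thm. 1, pp. 200–201] -/
theorem hRest_of_stubs
    (hT : ∀ (V V' : WeierstrassCurve ℚ) [V.IsElliptic] [V'.IsElliptic] (ψ : Isogeny V V'),
      ψ.IsCyclic → ψ.degree ∈ ({11, 14, 15, 17, 19, 21, 27, 37, 43, 67, 163} : Finset ℕ) →
        (ψ.degree, V.j) ∈ kenkuIsogenyJTable) :
    ∀ (V V' : WeierstrassCurve ℚ) [V.IsElliptic] [V'.IsElliptic] (ψ : Isogeny V V'),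
      ψ.IsCyclic → ψ.degree ∉ ({20, 24, 26, 32, 35, 36, 39, 49, 50, 65, 91, 125, 169, 55, 85,
        95, 185, 215, 335, 815, 77, 119, 133, 259, 301, 469, 1141, 143, 221, 247, 481, 559, 871,
        2119, 81} : Finset ℕ) := by
  intro V V' _ _ ψ hψ hmem
  have hB : ∀ N ∈ ({11, 17, 19, 37, 43, 67, 163} : Finset ℕ),
      N ∈ ({11, 14, 15, 17, 19, 21, 27, 37, 43, 67, 163} : Finset ℕ) := by decide
  -- a prime-degree sub-isogeny `q ∣ deg ψ` together with a tabulated `N`-sub-isogeny is excluded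
  have key : ∀ {q N : ℕ}, (q = 7 ∨ q = 13) → N ∈ ({11, 17, 19, 37, 43, 67, 163} : Finset ℕ) →
      ψ.degree = q * N → False := by
    intro q N hq hN hd
    obtain ⟨V₂, hV₂, ψN, hψNc, hψNd, -⟩ :=
      ψ.exists_isCyclic_degree_eq_of_dvd hψ (d := N) (hd ▸ dvd_mul_left N q)
    obtain ⟨V₃, hV₃, χ, -, hχd, -⟩ :=
      ψ.exists_isCyclic_degree_eq_of_dvd hψ (d := q) (hd ▸ dvd_mul_right q N)
    haveI := hV₂
    haveI := hV₃
    have hmemT := hT V V₂ ψN hψNc (hψNd ▸ hB N hN)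
    rw [hψNd] at hmemT
    have hχq : χ.degree = 7 ∨ χ.degree = 13 := by rw [hχd]; exact hq
    rcases kenkuIsogenyJTable_large _ hmemT hN with hj | hj | hj
    · exact stub_certEleven V V₃ χ hχq hj
    · exact stub_certMid V V₃ χ hχq hj
    · exact stub_certCM V V₃ χ hχq hj
  rcases residualLevels_split _ hmem with hD | ⟨N, hN, hd⟩ | ⟨N, hN, hd⟩ | ⟨N, hN, hd⟩ | h81
  · exact stub_kenkuDirect V V' ψ hψ hD
  · exact isCyclic_degree_ne_five_mul_of_jTable hT ψ hψ hN hd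
  · exact key (Or.inl rfl) hN hd
  · exact key (Or.inr rfl) hN hd
  · obtain ⟨V₂, hV₂, ψ₂₇, hc, hd27, -⟩ :=
      ψ.exists_isCyclic_degree_eq_of_dvd hψ (d := 27) (h81 ▸ (by norm_num : (27 : ℕ) ∣ 81))
    haveI := hV₂
    have hmemT := hT V V₂ ψ₂₇ hc (by rw [hd27]; decide)
    rw [hd27] at hmemT
    exact stub_eightyone V V' ψ hψ h81 (kenkuIsogenyJTable_twentyseven _ hmemT rfl)

/-- **Kenku's composite levels from the stubs**: `kenku_minimalLevels_mem_kenkuDegrees` (the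
tree's axiom-clean assembly `kenku_minimalLevels_mem_kenkuDegrees_of_schemas` fed with
`stub_kenkuTablesUnique` and `hRest_of_stubs`). [cite: Kenku1982, Thm. 1 and its proof, pp. 199–201] -/
theorem kenku_of_stubs : kenku_minimalLevels_mem_kenkuDegrees :=
  kenku_minimalLevels_mem_kenkuDegrees_of_schemas stub_kenkuTablesUnique.1
    stub_kenkuTablesUnique.2 (hRest_of_stubs stub_kenkuTablesUnique.2)

/-- **The Mazur–Kenku radius from the stubs**: two `ℚ`-isogenous elliptic curves over `ℚ` are
joined by a `ℚ`-isogeny of degree `≤ 163` — Mazur's Thm. 1 from `stub_cor44` and the tree's proof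
of Prop. 5.1 (`mazur_isogeny_irreducible_holds_of`), Kenku's fact from `kenku_of_stubs`, the
cyclic reduction (`mazurKenku_exists_cyclic_isogeny_of_mazur_of_kenku`) and
`exists_isogeny_degree_le_163`. This is the item stmt-ABC-15193 (`MazurKenkuRadius`) modulo the
stubs. [cite: Mazur1978, Thm. 1 (pp. 129–130)] [cite: Kenku1982, Thm. 1]
[cite: SilvermanAEC2009, IX.6 Example 6.4] -/
theorem mazurKenkuRadius_of_stubs : Summit.ABC.ABC.Theses.RibetTakahashiSplit.MazurKenkuRadius :=
  fun W W' _ _ hW ↦ exists_isogeny_degree_le_163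
    (mazurKenku_exists_cyclic_isogeny_of_mazur_of_kenku
      (mazur_isogeny_irreducible_holds_of stub_cor44
        Mazur1978.prop51_exponent_classes_of_additive_holds) kenku_of_stubs) W W' hW

/-- **The crux `MazurKenkuBound` (stmt-ABC-15125) from the seven stubs of line `Sketch`
(cycle 22)**: the landed `mazurKenkuBound_of_radiusItem` (p135527; the Edixhoven input is the
theorem `edixhovenIntegrality_proof`, p135258) applied to `mazurKenkuRadius_of_stubs`.
[cite: PastenShimura2024, §3 p. 13] [cite: Mazur1978, Thm. 1] [cite: Kenku1982, Thm. 1]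
[cite: EdixhovenManin1991, Prop. 2] -/
theorem MazurKenkuBound_of : Summit.ABC.ABC.Theses.IsogenyGlueCongruence.MazurKenkuBound :=
  mazurKenkuBound_of_radiusItem mazurKenkuRadius_of_stubs

end Summit.ABC.ABC.Theorems

end
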